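import Literature.AnabelianGeometry.SemiGraphs.SlimExtensions
import Literature.AnabelianGeometry.SemiGraphs.TemperedSpecialFibre
import Literature.AnabelianGeometry.SemiGraphs.TemperedCurvesAugOpen
import Literature.AnabelianGeometry.SemiGraphs.TemperedVerticialNamedFactsProofs
import Literature.AnabelianGeometry.AbsoluteAnabelian.MLFSlimKummerProofs
import HarnessLib

/-!
# [SemiAnbd] Example 3.10, the ARGUMENT (pp. 44–45): the special-fibre tower
# `Δ ↠ ⋯ ↠ Δ[i] = π₁^temp(𝒢_i) ⋊^out Δ_i ↠ ⋯ ↠ π₁^temp(𝒢)` and the temp-slimness of `Δ`, `Π`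
# — sub-DAG statements file (D-0068 (1), plan/L3/SUBDAG-SemiAnbd-Ex310.md)

Mochizuki, *Semi-graphs of anabelioids*, Publ. RIMS **42** (2006), §3 Example 3.10, manuscript
pp. 43–45 [cite: MochizukiSemiAnbd2006, Ex 3.10 pp.43-45].

The OBJECTS of Example 3.10 are typed elsewhere and are NOT re-declared here: the tempered
fundamental group `Π := π₁^temp(X^log_K) ↠ G_K` with `Δ := Ker` is the interface
`TemperedArithmeticGroup K` (`TemperedCurves.lean`, whose fields `isSlimGroup`, `isSlimGroup_ker`
RECORD the Example's conclusion "both `Δ` and `Π` are temp-slim" as interface axioms), the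
special-fibre semi-graph of anabelioids `𝒢^c` with its chart and admissible quotient
`Δ ↠ π₁^temp(𝒢^c)` is `SpecialFibreData D` / `SpecialFibreOrigin K` (`TemperedSpecialFibre.lean`),
the arithmetic (`Π`-level) tower of Example 5.6 is `StableReductionTower` (`ArithmeticCurves.lean`).

This file types the intermediate statements of the printed ARGUMENT of Example 3.10 (p. 44
l. 9 – p. 45 l. 12) by which the temp-slimness of `Δ` and `Π` is DERIVED, and proves its
group-theoretic steps in the kernel:
* `SpecialFibreTower Δ` — the data the argument introduces (p. 44): "an exhaustive sequence of open
  characteristic [hence normal] subgroups of finite index `… ⊆ N_i ⊆ … ⊆ Δ`", `Δ_i := Δ/N_i`, the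
  semi-graphs of anabelioids `𝒢_i` (here: with compact structure, `𝒢^c_i`; "`B^temp(𝒢_i) ⥲
  B^temp(𝒢^c_i)`") of the geometric special fibres of the coverings determined by the `N_i`, which
  "satisf[y] the hypotheses of Theorem 3.7, Corollary 3.9" (via Example 2.10), a chart
  `π₁^temp(𝒢_i)`, the admissible quotients `N_i ↠ π₁^temp(𝒢_i)` by their kernels `admKer i`
  (normal in the ambient group, so that "`Δ[i] := π₁^temp(𝒢_i) ⋊^out Δ_i`" IS the quotient
  `Δ / admKer i` and the surjections "`Δ ↠ … ↠ Δ[i] ↠ … ↠ Δ[j] ↠ …`" (p. 45 l. 1–4) are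
  `admKer i ≤ admKer j`), and "`Δ_i` acts faithfully … on `B^temp(𝒢_i)`" (p. 45 l. 5–7) in its
  group-theoretic form (the outer action of `Δ_i` on `π₁^temp(𝒢_i)` is faithful);
* `Ex310TowerStatement Ω` — the EXISTENCE of this tower for THE special-fibre data of a curve,
  as an origin-parametrised named `Prop` (FACT-policy: [André]'s `π₁^temp`, stable models and
  Example 2.10 are not constructed in the tree; nothing is asserted);
* `Ex310AndreComparisonStatement Ω`, `Ex310GraphEquivStatement Ω` — the two further printed
  assertions of Example 3.10 that no tree declaration names ("the tempered fundamental group of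
  [André], §4 … is a tempered topological group [and] fits into a natural exact sequence" as the
  identification of the interface datum WITH André's group, recorded as the existence of a
  certified datum; "we have a natural equivalence `B^temp(𝒢) ⥲ B^temp(𝒢^c)`"), origin-parametrised,
  nothing asserted;
* PROVED from the tower data, by the generic inferences of p. 45 l. 5–12 (file
  `SlimExtensions.lean`: `isSlimGroup_of_normal_of_centralizer_le`,
  `isSlimGroup_of_separating_quotients`, `isSlimGroup_of_slim_ker_of_slim_quotient`,
  `isSlimGroup_of_same_ker`): `SpecialFibreTower.isSlimGroup_level` ("each `Δ[i]` is temp-slim"),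
  `SpecialFibreTower.isSlimGroup_delta` ("`Δ` is the inverse limit of the `Δ[i]` … `Δ` [is]
  temp-slim") and `SpecialFibreTower.isSlimGroup_pi` ("and `G_K` is slim … `Π` [is] temp-slim") (the latter under the additive named hypothesis
  `TemperedArithmeticGroup.AugIsOpenMap` of `TemperedCurvesAugOpen.lean` and the slimness of
  `G_K`, which for `K/ℚ_p` finite is the tree THEOREM `galoisMLF_slim_holds`).
So a future construction of `π₁^temp` that produces a `SpecialFibreTower` fills the interface
fields `isSlimGroup_ker` / `isSlimGroup` of `TemperedArithmeticGroup` by these theorems instead of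
by fiat — which is the point of the cut (D-0068 (1)).

Deliberately NOT typed here (recorded so nothing is silently dropped): the semi-graph-level
"generalized morphisms of graphs of anabelioids `𝒢_i → 𝒢_j`" (Def. 2.11) and their description via
irreducible components and nodes of the special fibres (p. 44 l. 22–36; cf. Example 5.6,
`ArithmeticCurves.lean` fields `spV`/`spE`) — only their effect "`B^temp(−)`" on tempered
fundamental groups (Rmk. 2.11.1), i.e. the surjections `Δ[i] ↠ Δ[j]`, is recorded; the faithful
action of `Δ_i` on the semi-graph of anabelioids `𝒢_i` itself (p. 44 l. 16) — only its printed
consequence on `B^temp(𝒢_i)` (p. 45 l. 5–7, "the injectivity portion of the bijection of Corollary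
3.9") is a field; Remark 3.10.1 (pro-`Σ` version) is `ProSigmaQuotient` (`TemperedSpecialFibre.lean`).
"Characteristic" (p. 44 l. 9) is typed as stability under every automorphism of the TOPOLOGICAL group
`Δ` (`N_char`, not Mathlib's algebraic `Subgroup.Characteristic`, which would strengthen print)
together with its printed consequence "[hence normal]" (`N_normal`), which is what the argument
uses. No statement of the paper is strengthened; nothing disputed is touched
([SemiAnbd] is a refereed 2006 paper); typed ≠ proved for the origin-parametrised `Prop`s.
-/

open Topology

noncomputable section

namespace Literature.AnabelianGeometry.SemiGraphs

open Literature.AlgebraicGeometry.Frobenioids (IsSlimGroup)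
open Literature.AnabelianGeometry.AbsoluteAnabelian (galoisMLF_slim galoisMLF_slim_holds)

universe u

/-! ### Example 3.10 (p. 44): the special-fibre tower over `Δ` -/

section Tower

open ProfiniteSemiGraph

variable {Δ : Type u} [Group Δ] [TopologicalSpace Δ]

variable (Δ) in
/-- **[SemiAnbd] Example 3.10, the tower** (p. 44 l. 9 – p. 45 l. 7), as INTERFACE data over a
topological group `Δ` (in the Example, `Δ = π₁^temp(X^log_K̄)`, i.e. `↥D.delta` for
`D : TemperedArithmeticGroup K`):
* "an exhaustive sequence of open characteristic [hence normal] subgroups of finite index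
  `… ⊆ N_i ⊆ … ⊆ Δ` [where `i` ranges over the positive integers]" — `N`, antitone in `i : ℕ`,
  open, stable under the continuous automorphisms of `Δ`, normal, of finite index, with
  `⋂_i N_i = {1}`; "write `Δ_i := Δ/N_i`";
* "`N_i` determines a finite log étale covering of `X^log_K̄`, whose geometric special fiber gives
  rise to semi-graphs of anabelioids `𝒢_i`, `𝒢^c_i` on which `Δ_i` acts faithfully. Recall from
  Example 2.10 that `𝒢_i`, `𝒢^c_i` are coherent, totally elevated, totally universally
  sub-coverticial, totally estranged, and verticially slim. In particular, `𝒢_i` satisfies the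
  hypotheses of Theorem 3.7, Corollary 3.9" — `Gc i` (local presentation `ProfiniteSemiGraph`, with
  compact structure; "`B^temp(𝒢_i) ⥲ B^temp(𝒢^c_i)`"), `hyp i : Thm37Hypotheses`, and a tempered
  fundamental group `chart i` of it;
* the "natural morphisms of temperoids `… → B^temp(𝒢_i) → … → B^temp(𝒢_j) → … → B^temp(𝒢)`
  compatible with the actions of the `Δ_i`, hence also corresponding surjections of tempered groups
  `Δ ↠ … ↠ Δ[i] := π₁^temp(𝒢_i) ⋊^out Δ_i ↠ … ↠ Δ[j] := π₁^temp(𝒢_j) ⋊^out Δ_j ↠ … ↠ π₁^temp(𝒢)`"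
  (p. 44 l. −3 – p. 45 l. 4) — recorded through the admissible quotients `adm i : N_i ↠ π₁^temp(𝒢_i)`
  (open continuous surjections onto the charts) and their kernels `admKer i ⊴ Δ`, antitone in `i`,
  so that `Δ[i]` IS `Δ / admKer i` (an extension of `Δ_i = Δ/N_i` by `N_i/admKer i ≅ π₁^temp(𝒢_i)`,
  i.e. the outer semi-direct product of §0) and `Δ[i] ↠ Δ[j]` is `admKer i ≤ admKer j`;
* "`Δ_i` acts faithfully on `𝒢_i`, hence also faithfully on `B^temp(𝒢_i)` [cf., e.g., the
  injectivity portion of the bijection of Corollary 3.9]" (p. 45 l. 5–7) in the group-theoretic form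
  the argument uses — `faithful`: an element of `Δ` whose conjugation action on
  `π₁^temp(𝒢_i) = N_i / admKer i` is trivial lies in `N_i` (equivalently, the outer action
  `Δ_i → Out(π₁^temp(𝒢_i))` is injective, cf. `faithful_outer`).
The semi-graph-level generalized morphisms `𝒢_i → 𝒢_j` (Def. 2.11) and the action of `Δ_i` on the
semi-graph of anabelioids `𝒢_i` itself are not typed (see the module docstring). Nothing asserts
that such data exists: see `Ex310TowerStatement`. [cite: MochizukiSemiAnbd2006, Ex 3.10 p.44] -/
structure SpecialFibreTower : Type (u + 1) where
  /-- the exhaustive sequence `… ⊆ N_i ⊆ … ⊆ Δ` (p. 44 l. 9–11) -/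
  N : ℕ → Subgroup Δ
  /-- "`… ⊆ N_i ⊆ …`": the sequence is decreasing -/
  N_antitone : Antitone N
  /-- the `N_i` are open -/
  isOpen_N : ∀ i, IsOpen (N i : Set Δ)
  /-- the `N_i` are "characteristic": stable under every automorphism of the topological group `Δ` -/
  N_char : ∀ (i) (φ : Δ ≃ₜ* Δ), (N i).map φ.toMulEquiv.toMonoidHom = N i
  /-- "[hence normal]" -/
  N_normal : ∀ i, (N i).Normal
  /-- "of finite index" -/
  N_finiteIndex : ∀ i, (N i).FiniteIndex
  /-- "exhaustive": `⋂_i N_i = {1}` -/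
  N_exhaustive : ∀ g : Δ, (∀ i, g ∈ N i) → g = 1
  /-- `𝒢^c_i`, the semi-graph of anabelioids with compact structure of the geometric special fibre
  of the covering determined by `N_i` (p. 44 l. 12–14) -/
  Gc : ℕ → ProfiniteSemiGraph.{u}
  /-- "`𝒢_i` satisfies the hypotheses of Theorem 3.7, Corollary 3.9" (p. 44 l. 16–17, via Ex. 2.10) -/
  hyp : ∀ i, (Gc i).Thm37Hypotheses
  /-- a tempered fundamental group `π₁^temp(𝒢_i)` (Prop. 3.6 (i)(ii)) -/
  chart : ∀ i, TemperedPiChart (Gc i)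
  /-- the kernel `admKer i ⊆ N_i` of the admissible quotient `N_i ↠ π₁^temp(𝒢_i)`, i.e. the kernel
  of "`Δ ↠ Δ[i]`" (p. 45 l. 1–3) -/
  admKer : ℕ → Subgroup Δ
  /-- `admKer i ⊆ N_i` -/
  admKer_le : ∀ i, admKer i ≤ N i
  /-- `admKer i` is normal in `Δ` ("`Δ ↠ Δ[i]`" is a quotient of groups) -/
  admKer_normal : ∀ i, (admKer i).Normal
  /-- "`Δ[i] ↠ Δ[j]`" for `i ≥ j`: the kernels decrease with `i` -/
  admKer_antitone : Antitone admKer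
  /-- the admissible quotient `N_i ↠ π₁^temp(𝒢_i)` onto the chart (the level-`i` analogue of the
  "natural quotient `Δ ↠ π₁^temp(𝒢)`", p. 45, p. 48) -/
  adm : ∀ i, (N i) →ₜ* (chart i).G
  /-- it is surjective -/
  adm_surjective : ∀ i, Function.Surjective (adm i)
  /-- it is an open map (a quotient of tempered groups) -/
  isOpenMap_adm : ∀ i, IsOpenMap (adm i)
  /-- its kernel is `admKer i` -/
  ker_adm : ∀ i, (adm i).toMonoidHom.ker = (admKer i).subgroupOf (N i)
  /-- "`Δ_i` acts faithfully … on `B^temp(𝒢_i)`" (p. 45 l. 5–7): an element of `Δ` acting trivially by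
  conjugation on `π₁^temp(𝒢_i) = N_i / admKer i` lies in `N_i` -/
  faithful : ∀ (i) (g : Δ), (∀ n ∈ N i, g * n * g⁻¹ * n⁻¹ ∈ admKer i) → g ∈ N i

namespace SpecialFibreTower

variable (T : SpecialFibreTower Δ)

/-- "`Δ_i := Δ / N_i`" (p. 44 l. 11), a finite group. [cite: MochizukiSemiAnbd2006, Ex 3.10 p.44] -/
abbrev DeltaFin (i : ℕ) : Type u := Δ ⧸ T.N i

/-- "`Δ[i] := π₁^temp(𝒢_i) ⋊^out Δ_i`" (p. 45 l. 2), realised as the quotient `Δ / admKer i` through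
which "`Δ ↠ Δ[i]`" factors. [cite: MochizukiSemiAnbd2006, Ex 3.10 p.45] -/
abbrev Level (i : ℕ) : Type u := Δ ⧸ T.admKer i

/-- `Δ_i` is finite ("of finite index"). (A theorem, not an instance: statements files declare no
instances; consumers use `haveI`.) [cite: MochizukiSemiAnbd2006, Ex 3.10 p.44] -/
theorem finite_deltaFin (i : ℕ) : Finite (T.DeltaFin i) :=
  haveI := T.N_finiteIndex i
  Subgroup.finite_quotient_of_finiteIndex

/-- The image `π₁^temp(𝒢_i) = N_i / admKer i` of `N_i` in `Δ[i] = Δ / admKer i` (p. 45 l. 2: the normal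
subgroup of the outer semi-direct product). [cite: MochizukiSemiAnbd2006, Ex 3.10 p.45] -/
def piTempImage (i : ℕ) [(T.admKer i).Normal] : Subgroup (T.Level i) :=
  (T.N i).map (QuotientGroup.mk' (T.admKer i))

/-- `π₁^temp(𝒢_i) ⊴ Δ[i]` (a theorem, not an instance; the normality of `admKer i` is the field
`admKer_normal`, supplied by `haveI`). [cite: MochizukiSemiAnbd2006, Ex 3.10 p.45] -/
theorem piTempImage_normal (i : ℕ) [(T.admKer i).Normal] : (T.piTempImage i).Normal :=
  (T.N_normal i).map _ (QuotientGroup.mk'_surjective _)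

/-- "`… ⊆ N_i ⊆ …`" entails `⋂_i admKer i = {1}` as well: "`Δ` is the inverse limit of the `Δ[i]`"
(p. 45 l. 10) in the form the slimness argument uses (`Δ ↪ ∏_i Δ[i]`).
[cite: MochizukiSemiAnbd2006, Ex 3.10 p.45] -/
theorem admKer_separating (g : Δ) (hg : ∀ i, g ∈ T.admKer i) : g = 1 :=
  T.N_exhaustive g fun i => T.admKer_le i (hg i)

/-- The faithfulness field in its printed OUTER form: an element of `Δ` whose conjugation action on
`π₁^temp(𝒢_i) = N_i / admKer i` is INNER (induced by some `n₀ ∈ N_i`) already lies in `N_i` — i.e. the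
outer action `Δ_i → Out(π₁^temp(𝒢_i))` is injective ("`Δ_i` acts faithfully … on `B^temp(𝒢_i)`",
p. 45 l. 5–7; an automorphism of a temperoid up to isomorphism = an outer automorphism of its
tempered fundamental group, Prop. 3.2). [cite: MochizukiSemiAnbd2006, Ex 3.10 p.45] -/
theorem faithful_outer (i : ℕ) (g n₀ : Δ) (hn₀ : n₀ ∈ T.N i)
    (h : ∀ n ∈ T.N i, g * n * g⁻¹ * (n₀ * n * n₀⁻¹)⁻¹ ∈ T.admKer i) : g ∈ T.N i := by
  -- `n₀⁻¹ g` acts trivially, hence lies in `N_i`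
  have h' : n₀⁻¹ * g ∈ T.N i := by
    refine T.faithful i (n₀⁻¹ * g) fun n hn => ?_
    have h2 : n₀⁻¹ * (g * n * g⁻¹ * (n₀ * n * n₀⁻¹)⁻¹) * n₀⁻¹⁻¹ ∈ T.admKer i :=
      (T.admKer_normal i).conj_mem _ (h n hn) n₀⁻¹
    have : n₀⁻¹ * g * n * (n₀⁻¹ * g)⁻¹ * n⁻¹ =
        n₀⁻¹ * (g * n * g⁻¹ * (n₀ * n * n₀⁻¹)⁻¹) * n₀⁻¹⁻¹ := by group
    rw [this]
    exact h2
  simpa using (T.N i).mul_mem hn₀ h'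

/-- **"`𝒢_i` satisfies the hypotheses of … Corollary 3.9 … the temp-slimness portion of Proposition
3.6, (iv)"** (p. 44 l. 17, p. 45 l. 7): the chart `π₁^temp(𝒢_i)` is slim — by the tree THEOREM
`temperedPiSlim_holds` ([SemiAnbd] Prop. 3.6 (iv), last sentence). [cite: MochizukiSemiAnbd2006, Ex 3.10 p.45] -/
theorem isSlimGroup_chart (i : ℕ) : IsSlimGroup (T.chart i).G :=
  ProfiniteSemiGraph.temperedPiSlim_holds (T.Gc i) (T.hyp i).toProp36Hypotheses (T.chart i)

/-- The image `π₁^temp(𝒢_i) = N_i / admKer i ⊆ Δ[i]` is slim (transport of `isSlimGroup_chart` along the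
two quotients of `N_i` by `admKer i`). [cite: MochizukiSemiAnbd2006, Ex 3.10 p.45] -/
theorem isSlimGroup_piTempImage (i : ℕ) [(T.admKer i).Normal] : IsSlimGroup (T.piTempImage i) := by
  let q : Δ →* T.Level i := QuotientGroup.mk' (T.admKer i)
  let f₂ : T.N i →* T.piTempImage i := q.subgroupMap (T.N i)
  have hf₂c : Continuous f₂ := by
    refine Continuous.subtype_mk ?_ _
    exact (QuotientGroup.continuous_mk (N := T.admKer i)).comp continuous_subtype_val
  have hf₂s : Function.Surjective f₂ := q.subgroupMap_surjective (T.N i)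
  refine isSlimGroup_of_same_ker (T.adm i).toMonoidHom (T.isOpenMap_adm i) (T.isSlimGroup_chart i)
    f₂ hf₂c hf₂s ?_
  rw [T.ker_adm i]
  ext ⟨n, hn⟩
  simp only [Subgroup.mem_subgroupOf, MonoidHom.mem_ker]
  rw [Subtype.ext_iff]
  change n ∈ T.admKer i ↔ (q n : T.Level i) = 1
  rw [QuotientGroup.mk'_apply, QuotientGroup.eq_one_iff]

/-- Faithfulness inside `Δ[i]`: every element of `Δ[i] = Δ / admKer i` centralising
`π₁^temp(𝒢_i) = N_i / admKer i` lies in it. [cite: MochizukiSemiAnbd2006, Ex 3.10 p.45] -/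
theorem centralizer_piTempImage_le (i : ℕ) [(T.admKer i).Normal] :
    Subgroup.centralizer (T.piTempImage i : Set (T.Level i)) ≤ T.piTempImage i := by
  intro z hz
  obtain ⟨g, rfl⟩ := QuotientGroup.mk'_surjective (T.admKer i) z
  have hzc := Subgroup.mem_centralizer_iff.mp hz
  have hg : g ∈ T.N i := by
    refine T.faithful i g fun n hn => ?_
    have h1 : (QuotientGroup.mk' (T.admKer i) n) * QuotientGroup.mk' (T.admKer i) g =
        QuotientGroup.mk' (T.admKer i) g * QuotientGroup.mk' (T.admKer i) n :=
      hzc _ ⟨n, hn, rfl⟩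
    rw [← map_mul, ← map_mul, QuotientGroup.mk'_apply, QuotientGroup.mk'_apply,
      QuotientGroup.eq] at h1
    -- `h1 : (n * g)⁻¹ * (g * n) ∈ admKer i`
    have : g * n * g⁻¹ * n⁻¹ = (g * n) * ((n * g)⁻¹ * (g * n)) * (g * n)⁻¹ := by group
    rw [this]
    exact (T.admKer_normal i).conj_mem _ h1 _
  exact ⟨g, hg, rfl⟩

/-- **"Note that each `Δ[i]` is temp-slim"** ([SemiAnbd] Ex. 3.10 p. 45 l. 5), PROVED from the tower
data: `Δ[i] = Δ / admKer i` is slim. [cite: MochizukiSemiAnbd2006, Ex 3.10 p.45] -/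
theorem isSlimGroup_level [IsTopologicalGroup Δ] (i : ℕ) [(T.admKer i).Normal] :
    IsSlimGroup (T.Level i) :=
  haveI := T.piTempImage_normal i
  isSlimGroup_of_normal_of_centralizer_le (T.piTempImage i) (T.isSlimGroup_piTempImage i)
    (T.centralizer_piTempImage_le i)

include T in
/-- **"Since `Δ` is the inverse limit of the `Δ[i]` … we thus conclude that … `Δ` [is] temp-slim"**
([SemiAnbd] Ex. 3.10 p. 45 l. 10–12), PROVED from the tower data.
[cite: MochizukiSemiAnbd2006, Ex 3.10 p.45] -/
theorem isSlimGroup_delta [IsTopologicalGroup Δ] : IsSlimGroup Δ :=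
  haveI : ∀ i, (T.admKer i).Normal := T.admKer_normal
  isSlimGroup_of_separating_quotients T.admKer T.admKer_separating fun i => T.isSlimGroup_level i

end SpecialFibreTower

end Tower

/-! ### Example 3.10, conclusion for `Π`, and the origin-parametrised named statements -/

section Conclusion

open ProfiniteSemiGraph

variable {K : Type u} [Field K]

/-- The tower LIES OVER the special-fibre data `S` of the curve: "`… ↠ Δ[j] ↠ … ↠ π₁^temp(𝒢)`"
(p. 45 l. 3–4) — the admissible quotient `Δ ↠ π₁^temp(𝒢^c)` of `S` factors through every `Δ[i]`.
[cite: MochizukiSemiAnbd2006, Ex 3.10 p.45] -/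
def SpecialFibreTower.LiesOver {D : TemperedArithmeticGroup K} (T : SpecialFibreTower D.delta)
    (S : SpecialFibreData D) : Prop :=
  ∀ i, T.admKer i ≤ S.admissible.toMonoidHom.ker

/-- **Example 3.10, conclusion "both `Δ` and `Π` are temp-slim"** (p. 45 l. 11–12), the `Π`-half
PROVED from: a special-fibre tower over `Δ = D.delta`, the slimness of `G_K` ("`G_K` is slim [cf.,
e.g., [Mzk3], Theorem 1.1.1]") and the openness of the augmentation `Π ↠ G_K` (the additive named
hypothesis `TemperedArithmeticGroup.AugIsOpenMap`: the printed exact sequence is one of topological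
groups). The proof does not use the interface fields `D.isSlimGroup`, `D.isSlimGroup_ker`.
[cite: MochizukiSemiAnbd2006, Ex 3.10 p.45] -/
theorem SpecialFibreTower.isSlimGroup_pi {D : TemperedArithmeticGroup K}
    (T : SpecialFibreTower D.delta) (haug : D.AugIsOpenMap)
    (hG : IsSlimGroup (Field.absoluteGaloisGroup K)) : IsSlimGroup D.Pi := by
  refine isSlimGroup_of_slim_ker_of_slim_quotient D.aug.toMonoidHom (fun U hU => ?_)
    T.isSlimGroup_delta hG
  rw [Subgroup.coe_map]
  exact haug _ hU

/-- **Example 3.10, conclusion, for `K/ℚ_p` finite** (the printed setting, p. 43 "Let `K` be a finite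
extension of `ℚ_p`"): both `Δ` and `Π` are (temp-)slim, from a special-fibre tower and the openness
of the augmentation — the slimness of `G_K` being the tree THEOREM `galoisMLF_slim_holds`
([AbsAnab] Thm. 1.1.1 (ii)). [cite: MochizukiSemiAnbd2006, Ex 3.10 p.45] -/
theorem SpecialFibreTower.isSlimGroup_delta_and_pi {p : ℕ} [Fact p.Prime] {K : Type} [Field K]
    [Algebra ℚ_[p] K] [FiniteDimensional ℚ_[p] K] {D : TemperedArithmeticGroup K}
    (T : SpecialFibreTower D.delta) (haug : D.AugIsOpenMap) :
    IsSlimGroup D.delta ∧ IsSlimGroup D.Pi :=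
  ⟨T.isSlimGroup_delta, T.isSlimGroup_pi haug (galoisMLF_slim_holds p K)⟩

/-- **[SemiAnbd] Example 3.10, the tower EXISTS** (p. 44 l. 9 – p. 45 l. 4), as an
origin-parametrised named statement (FACT-policy: André's `π₁^temp`, stable models of the coverings
and Example 2.10 are not constructed in the tree; ASSUMED by consumers as `(h : Ex310TowerStatement Ω)`,
asserted for no `Ω`): for THE special-fibre data `S` of the curve underlying `D` and ANY "exhaustive
sequence of open characteristic [hence normal] subgroups of finite index `… ⊆ N_i ⊆ … ⊆ Δ`", the
coverings determined by the `N_i` furnish a special-fibre tower with these `N_i`, lying over `S`.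
[cite: MochizukiSemiAnbd2006, Ex 3.10 p.44] -/
def Ex310TowerStatement (Ω : SpecialFibreOrigin K) : Prop :=
  ∀ (D : TemperedArithmeticGroup K) (S : SpecialFibreData D), Ω.IsSpecialFibreOf D S →
    ∀ (N : ℕ → Subgroup D.delta), Antitone N → (∀ i, IsOpen (N i : Set D.delta)) →
      (∀ (i) (φ : D.delta ≃ₜ* D.delta), (N i).map φ.toMulEquiv.toMonoidHom = N i) →
      (∀ i, (N i).Normal) → (∀ i, (N i).FiniteIndex) → (∀ g, (∀ i, g ∈ N i) → g = 1) →
        ∃ T : SpecialFibreTower D.delta, T.N = N ∧ T.LiesOver S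

/-- What the named statement buys (the printed conclusion of Example 3.10 for a certified datum):
under `Ex310TowerStatement Ω`, the additive hypothesis `AugIsOpenMap`, the slimness of `G_K`, and the
existence of SOME exhaustive sequence of open characteristic normal finite-index subgroups of `Δ`
(print: "Now suppose that we are given an exhaustive sequence …"), the groups `Δ` and `Π` of a datum
`D` carrying certified special-fibre data are slim — WITHOUT appeal to the interface fields
`isSlimGroup`/`isSlimGroup_ker`. [cite: MochizukiSemiAnbd2006, Ex 3.10 p.45] -/
theorem isSlimGroup_of_ex310TowerStatement {Ω : SpecialFibreOrigin K} (h : Ex310TowerStatement Ω)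
    {D : TemperedArithmeticGroup K} {S : SpecialFibreData D} (hS : Ω.IsSpecialFibreOf D S)
    (N : ℕ → Subgroup D.delta) (hanti : Antitone N) (hopen : ∀ i, IsOpen (N i : Set D.delta))
    (hchar : ∀ (i) (φ : D.delta ≃ₜ* D.delta), (N i).map φ.toMulEquiv.toMonoidHom = N i)
    (hnormal : ∀ i, (N i).Normal) (hfi : ∀ i, (N i).FiniteIndex)
    (hexh : ∀ g, (∀ i, g ∈ N i) → g = 1) (haug : D.AugIsOpenMap)
    (hG : IsSlimGroup (Field.absoluteGaloisGroup K)) :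
    IsSlimGroup D.delta ∧ IsSlimGroup D.Pi := by
  obtain ⟨T, -, -⟩ := h D S hS N hanti hopen hchar hnormal hfi hexh
  exact ⟨T.isSlimGroup_delta, T.isSlimGroup_pi haug hG⟩

end Conclusion

end Literature.AnabelianGeometry.SemiGraphs

end
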